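import Summits.BirchSwinnertonDyer.BirchSwinnertonDyer.Theorems.KolyvaginRankRigidityAtTwoOffHabitatIrredBoundedDefectDepthZero
import Summits.BirchSwinnertonDyer.BirchSwinnertonDyer.Theorems.KolyvaginRankRigidityAtTwoOffHabitatIrredWindowPrime
import Summits.BirchSwinnertonDyer.BirchSwinnertonDyer.Theorems.KolyvaginRankRigidityAtTwoOffHabitatIrredKolyvaginRelationAtTwo
import Summits.BirchSwinnertonDyer.BirchSwinnertonDyer.Theorems.KolyvaginRankRigidityAtTwoOffHabitatIrredInflationDefectOfOpenImage
import Summits.BirchSwinnertonDyer.BirchSwinnertonDyer.Theorems.Rank1ResidualJetCompatibleData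
import Literature.NumberTheory.EllipticCurves.HeegnerPointsOfConductorRationalityProofs
import HarnessLib

/-!
# Route `KolyvaginRankRigidityAtTwo`, residual crux R_irr `OffHabitatIrredNonSurjTwoConverse`
# (stmt-BirchSwinnertonDyer-27123, LINE 8∞): KOLYVAGIN'S PROPAGATION AT 2 OFF THE HABITAT — U1irr's bounded defect at
# depth `r` ⇒ at depth `r + 1` (losing `c₁ = k + 1` bits), modulo Gross 1991 Prop. 3.7 (2) and Serre's open image;
# corollary: `y_K` of infinite order ⇒ U1irr's conclusion at EVERY depth (width seat krr2-p2 g10; helper, `--supports` 27123)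

The habitat rung `KolyvaginAtTwo.boundedDefectAtTwo_depth_succ_of_prop37` / `…_allDepths_of_nonTorsion_of_prop37`
(krr2-p2 g8, `--supports` 28083) VERBATIM with the binder `(∀ m, ρ_{E,2^m} onto)` replaced by R_irr's `E(ℚ)[2] = 0` and
its three image uses re-threaded: S2 ↦ `chebotarevOneClassIndexAtTwo_offHabitat hSerre` (p655785, `c₁ = k + 1`), Q2 ↦
`GenusExact.kolyvaginRelationAtTwo_offHabitat_of_frobeniusCongruence h37` (p650518), depth-zero rung ↦
`boundedDefectAtTwo_depthZero_of_nonTorsion_offHabitat` (p650760, unconditional). Kolyvagin's monotonicity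
`m_{r+1} ≤ m_r` at the prime `2` in U1irr's bounded-defect currency: from `2^(M−m−1)·c_M(n) ≠ 0` (depth `r`, `M ≤ M(n)`),
a FRESH Kolyvagin prime `q ∤ n` of index `≥ M` with `2^(M−m−1−c₁)·c_M(n) ∉ ker loc_λ` (S2 off habitat), a compatible
datum at `n·q` (`JET.exists_compatible_data_of_grossCM`), and Q2 off habitat carry it to `2^(M−m−1−c₁)·c_M(nq) ≠ 0`.
* `boundedDefectAtTwoIrr_depth_succ_of_prop37 (h37) (hSerre)` — U1irr's per-depth clause at `(r, m)` ⇒ at `(r+1, m+c₁)`;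
* `boundedDefectAtTwoIrr_allDepths_of_nonTorsion_of_prop37 (h37) (hSerre)` — `P(1)` of infinite order ⇒ U1irr's
  conclusion at every depth `r` (so U1irr holds on every R_irr frame with `y_K` non-torsion; the torsion-`y_K` frames —
  Kolyvagin's Conjecture A at `2` proper — are NOT touched).
HONEST FRAMING: CONDITIONAL on the named print facts `GrossLMS1991.prop37_2_frobeniusCongruence` and
`serre_adicImage_contains_congruenceSubgroup`; helper (`--supports` 27123); U1irr stays OPEN; BSD is NOT proved.
References: [Kolyvagin1991MathAnn] §2 (p. 257), (2.1); [McCallumLMS1991] §4 Prop. 4.4, §5 Prop. 5.2; [GrossLMS1991] §3,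
Prop. 3.7 (2); [Jetchev2008] §4 (ℳ_{r+1} ≤ ℳ_r); [SilvermanAEC2009] Thm. III.7.9 (a).
-/

set_option autoImplicit false
-- the Theorems namespace of this sub repeats the summit name by design (D-0017 nested layout)
set_option linter.dupNamespace false

noncomputable section

open scoped Classical

open WeierstrassCurve Field Literature.NumberTheory.EllipticCurves
  Literature.NumberTheory.EllipticCurves.ModularForms NumberField IsDedekindDomain
open Summit.BirchSwinnertonDyer.BirchSwinnertonDyer.Theses.KolyvaginRankRigidityAtTwo
open Literature.NumberTheory.EllipticCurves.GrossLMS1991 (prop37_2_frobeniusCongruence)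
open Summit.BirchSwinnertonDyer.BirchSwinnertonDyer.Theorems.KolyvaginLowerBoundAtTwo
  (chebotarevOneClassIndexAtTwo_offHabitat)

namespace Summit.BirchSwinnertonDyer.BirchSwinnertonDyer.Theorems.KolyvaginAtTwo

/-- Cast bookkeeping: `((2^k : ℕ) : ℤ) = (2 : ℤ)^k`. [folklore] -/
private theorem natCast_two_pow' (k : ℕ) : ((2 ^ k : ℕ) : ℤ) = (2 : ℤ) ^ k := by push_cast; rfl

/-- **Kolyvagin's PROPAGATION at `2` (one fresh prime) OFF THE HABITAT, modulo Gross 3.7 (2) and Serre**: on R_irr's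
frame, U1irr's per-depth clause at `(r, m)` — at every level `M > m` a depth-`r` conductor `n` with `M ≤ M(n)` and
`2^(M−m−1)·c_M(n) ≠ 0` — implies the clause at `(r + 1, m + c₁)`, `c₁` the constant of S2 off habitat. The new conductor
is `n·q` for a fresh Kolyvagin prime `q` of index `≥ M` seeing `2^(M−m−1−c₁)·c_M(n)` locally; the datum at `n·q` is
bsd-jet's compatible extension; the local order passes to `c_M(nq)` by Q2 off habitat.
[cite: Kolyvagin1991MathAnn, §2, p. 257] [cite: McCallumLMS1991, §4 Prop. 4.4, §5 Prop. 5.2] [cite: Jetchev2008, §4]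
[cite: GrossLMS1991, Prop. 3.7 (2)] [cite: SilvermanAEC2009, Thm. III.7.9 (a)] -/
theorem boundedDefectAtTwoIrr_depth_succ_of_prop37 (h37 : prop37_2_frobeniusCongruence)
    (hSerre : serre_adicImage_contains_congruenceSubgroup) :
    ∀ (W : WeierstrassCurve ℚ) [W.IsElliptic] [W.IsGloballyMinimal], ¬ W.HasCM →
      (Literature.NumberTheory.EllipticCurves.Rank1Residual.GoodOrd W 2 ∨
        Literature.NumberTheory.EllipticCurves.Rank1Residual.Mult W 2) →
      ¬ (∀ m : ℕ, W.HasSurjectiveModNGaloisRep (2 ^ m : ℕ)) → AddSubgroup.torsionBy W.toAffine.Point (2 : ℤ) = ⊥ →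
      ∀ (K : Type) [Field K] [NumberField K], Literature.NumberTheory.EllipticCurves.IsImaginaryQuadratic K →
      ∀ [NeZero (W.conductorNorm ℤ)],
      Literature.NumberTheory.EllipticCurves.SatisfiesHeegnerHypothesis (W.conductorNorm ℤ) K →
      Odd (NumberField.discr K) → NumberField.discr K ≠ -3 →
      AddSubgroup.torsionBy (W.baseChange K).toAffine.Point (2 : ℤ) = ⊥ →
      Literature.NumberTheory.EllipticCurves.SatisfiesHeegnerHypothesis 2 K →
      ∀ (Dt : Literature.NumberTheory.EllipticCurves.ModularForms.ModularParametrizationData W (W.conductorNorm ℤ))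
        (β : ℤ) (ι : K →+* ℂ), (4 * (W.conductorNorm ℤ : ℤ)) ∣ β ^ 2 - NumberField.discr K →
      ∃ c₁ : ℕ, ∀ r m : ℕ,
        (∀ M : ℕ, m < M →
          ∃ (n : ℕ) (d : Literature.NumberTheory.EllipticCurves.KolyvaginHeegnerData Dt β ι n),
            Literature.NumberTheory.EllipticCurves.KolyvaginDescent.KolSupp
              (Literature.NumberTheory.EllipticCurves.Zhang2014.IsKolyvaginPrime (W.conductorNorm ℤ) W K 2) n ∧
            n.primeFactors.card = r ∧
            ((M : ℕ) : ℕ∞) ≤ Literature.NumberTheory.EllipticCurves.Zhang2014.levelIndex W 2 n ∧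
            (2 ^ (M - m - 1) : ℤ) • d.kolyvaginClass Nat.prime_two M ≠ 0) →
        ∀ M : ℕ, m + c₁ < M →
          ∃ (n : ℕ) (d : Literature.NumberTheory.EllipticCurves.KolyvaginHeegnerData Dt β ι n),
            Literature.NumberTheory.EllipticCurves.KolyvaginDescent.KolSupp
              (Literature.NumberTheory.EllipticCurves.Zhang2014.IsKolyvaginPrime (W.conductorNorm ℤ) W K 2) n ∧
            n.primeFactors.card = r + 1 ∧
            ((M : ℕ) : ℕ∞) ≤ Literature.NumberTheory.EllipticCurves.Zhang2014.levelIndex W 2 n ∧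
            (2 ^ (M - (m + c₁) - 1) : ℤ) • d.kolyvaginClass Nat.prime_two M ≠ 0 := by
  intro W _ _ hCM hred _ htorQ K _ _ hK _ hHN hodd hne3 _ _ Dt β ι _
  set N := W.conductorNorm ℤ with hN
  -- R_irr's frame in S2's / Q2's spelling
  have h2d : ¬ ((2 : ℤ) ∣ NumberField.discr K) := fun h ↦
    (Int.not_even_iff_odd.mpr hodd) (even_iff_two_dvd.mpr h)
  have hne4 : NumberField.discr K ≠ -4 := fun h ↦ h2d (by rw [h]; norm_num)
  have hD : NumberField.discr K < -4 :=
    Summit.BirchSwinnertonDyer.Rank1Residual.X11b.KolyvaginAssembly.discr_lt_neg_four hK ⟨hne3, hne4⟩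
  obtain ⟨c₁, hS2⟩ := chebotarevOneClassIndexAtTwo_offHabitat hSerre W hCM hred htorQ K hK hne3 hne4 h2d hHN
  refine ⟨c₁, fun r m hU M hM ↦ ?_⟩
  obtain ⟨n, d, hn, hcard, hlev, hne⟩ := hU M (by omega)
  have hn0 : n ≠ 0 := hn.1.ne_zero
  have hM1 : 1 ≤ M := by omega
  -- the given class is `2^(M-m-1)`-large, `M - m - 1 ≥ c₁`
  have hne' : ((2 ^ (M - m - 1) : ℕ) : ℤ) • d.kolyvaginClass Nat.prime_two M ≠ 0 := by
    rw [natCast_two_pow' (M - m - 1)]; exact hne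
  -- S2 off habitat: a fresh Kolyvagin prime `q ∤ n` of index `≥ M` and a place `v ∣ q` seeing `2^(M-m-1-c₁) c_M(n)`
  obtain ⟨q, hqX, hqKol, hqI, v, hv, hloc⟩ :=
    hS2 Dt β ι n d M (M - m - 1) M hn hM1 hlev le_rfl (by omega) hne' n.primeFactors
  have hq : q.Prime := hqKol.1
  have hqn : ¬ q ∣ n := fun h ↦ hqX (Nat.mem_primeFactors.mpr ⟨hq, h, hn0⟩)
  have hnq : Squarefree (n * q) :=
    (Nat.squarefree_mul ((Nat.Prime.coprime_iff_not_dvd hq).mpr hqn).symm).mpr ⟨hn.1, hq.squarefree⟩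
  have hpf : (n * q).primeFactors = n.primeFactors ∪ {q} := by
    rw [Nat.primeFactors_mul hn0 hq.ne_zero, hq.primeFactors]
  have hKolall : ∀ l' ∈ (n * q).primeFactors, Zhang2014.IsKolyvaginPrime N W K 2 l' ∧
      M ≤ Zhang2014.kolyvaginIndex W 2 l' := by
    intro l' hl'
    rw [hpf, Finset.mem_union, Finset.mem_singleton] at hl'
    rcases hl' with h | rfl
    · exact ⟨hn.2 l' h, (Zhang2014.natCast_le_levelIndex_iff.mp hlev) l' h⟩
    · exact ⟨hqKol, hqI⟩
  -- a datum at `n q` compatible with `d` (bsd-jet, Gross §3 CM fact PROVED)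
  obtain ⟨dℓ, hdℓ⟩ := Summit.BirchSwinnertonDyer.Rank1Residual.JET.exists_compatible_data_of_grossCM
    (phi_heegnerPointOfConductor_mem_range_map_ringClassField_holds N W K) hK hD hHN 2 Dt β ι hn.1 hn.2 d
  obtain ⟨hσ, hS, hS', hemb⟩ := hdℓ q hqKol hqX
  set d' := dℓ q hqKol hqX with hd'
  -- Q2 off habitat at `λ ∣ q`: the local (non-)triviality of `2^j c_M(nq)` is that of `2^j c_M(n)`
  have hrel := GenusExact.kolyvaginRelationAtTwo_offHabitat_of_frobeniusCongruence h37 W hCM K hK hne3 hne4 hHN htorQ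
    Dt β ι M hM1 n q hnq hq hqn hKolall d d' hσ hS hS' hemb v hv (M - m - 1 - c₁)
  have hloc' : ((2 ^ (M - m - 1 - c₁) : ℕ) : ℤ) • d'.kolyvaginClass Nat.prime_two M ∉
      (W.baseChange K).torsionLocalKer (v.adicCompletion K) ((2 ^ M : ℕ) : ℤ) :=
    fun h ↦ hloc (hrel.2.mp h)
  -- read off
  refine ⟨n * q, d', ⟨hnq, fun l' hl' ↦ (hKolall l' hl').1⟩, ?_, ?_, ?_⟩
  · rw [hpf, Finset.card_union_of_disjoint (Finset.disjoint_singleton_right.mpr hqX), hcard,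
      Finset.card_singleton]
  · exact Zhang2014.natCast_le_levelIndex_iff.mpr fun l' hl' ↦ (hKolall l' hl').2
  · have hj : M - (m + c₁) - 1 = M - m - 1 - c₁ := by omega
    rw [hj, ← natCast_two_pow' (M - m - 1 - c₁)]
    intro h0
    exact hloc' (by rw [h0]; exact zero_mem _)

/-- **`y_K` of infinite order ⇒ U1irr's bounded defect at EVERY depth, off the habitat** (modulo Gross 3.7 (2) and
Serre): on R_irr's frame with some conductor-`1` datum whose `P(1)` has infinite order, for every depth `r` there is a
defect bound `m` (`m₀ + r·c₁`) such that at every level `M > m` some depth-`r` Kolyvagin conductor `n` with `M ≤ M(n)`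
carries `2^(M−m−1)·c_M(n) ≠ 0`. Induction on `r`: the off-habitat depth-zero rung
`boundedDefectAtTwo_depthZero_of_nonTorsion_offHabitat` (unconditional) and the propagation step. The torsion-`y_K`
frames (Kolyvagin's Conjecture A at `2` proper) are NOT touched. [cite: Kolyvagin1991MathAnn, §2 (m_{r+1} ≤ m_r), p. 259 (2.1)]
[cite: McCallumLMS1991, §5 Prop. 5.2] [cite: GrossLMS1991, Prop. 3.7 (2)] [cite: SilvermanAEC2009, Thm. III.7.9 (a)] -/
theorem boundedDefectAtTwoIrr_allDepths_of_nonTorsion_of_prop37 (h37 : prop37_2_frobeniusCongruence)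
    (hSerre : serre_adicImage_contains_congruenceSubgroup) :
    ∀ (W : WeierstrassCurve ℚ) [W.IsElliptic] [W.IsGloballyMinimal], ¬ W.HasCM →
      (Literature.NumberTheory.EllipticCurves.Rank1Residual.GoodOrd W 2 ∨
        Literature.NumberTheory.EllipticCurves.Rank1Residual.Mult W 2) →
      ¬ (∀ m : ℕ, W.HasSurjectiveModNGaloisRep (2 ^ m : ℕ)) → AddSubgroup.torsionBy W.toAffine.Point (2 : ℤ) = ⊥ →
      ∀ (K : Type) [Field K] [NumberField K], Literature.NumberTheory.EllipticCurves.IsImaginaryQuadratic K →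
      ∀ [NeZero (W.conductorNorm ℤ)],
      Literature.NumberTheory.EllipticCurves.SatisfiesHeegnerHypothesis (W.conductorNorm ℤ) K →
      Odd (NumberField.discr K) → NumberField.discr K ≠ -3 →
      AddSubgroup.torsionBy (W.baseChange K).toAffine.Point (2 : ℤ) = ⊥ →
      Literature.NumberTheory.EllipticCurves.SatisfiesHeegnerHypothesis 2 K →
      ∀ (Dt : Literature.NumberTheory.EllipticCurves.ModularForms.ModularParametrizationData W (W.conductorNorm ℤ))
        (β : ℤ) (ι : K →+* ℂ), (4 * (W.conductorNorm ℤ : ℤ)) ∣ β ^ 2 - NumberField.discr K →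
      (∃ d₁ : Literature.NumberTheory.EllipticCurves.KolyvaginHeegnerData Dt β ι 1, ¬ IsOfFinAddOrder d₁.derivedPoint) →
      ∀ r : ℕ, ∃ m : ℕ, ∀ M : ℕ, m < M →
        ∃ (n : ℕ) (d : Literature.NumberTheory.EllipticCurves.KolyvaginHeegnerData Dt β ι n),
          Literature.NumberTheory.EllipticCurves.KolyvaginDescent.KolSupp
            (Literature.NumberTheory.EllipticCurves.Zhang2014.IsKolyvaginPrime (W.conductorNorm ℤ) W K 2) n ∧
          n.primeFactors.card = r ∧
          ((M : ℕ) : ℕ∞) ≤ Literature.NumberTheory.EllipticCurves.Zhang2014.levelIndex W 2 n ∧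
          (2 ^ (M - m - 1) : ℤ) • d.kolyvaginClass Nat.prime_two M ≠ 0 := by
  intro W _ _ hCM hred hns htorQ K _ _ hK _ hHN hodd hne3 htor hH2 Dt β ι hβ hex r
  obtain ⟨c₁, hstep⟩ :=
    boundedDefectAtTwoIrr_depth_succ_of_prop37 h37 hSerre W hCM hred hns htorQ K hK hHN hodd hne3 htor hH2 Dt β ι hβ
  induction r with
  | zero =>
    exact boundedDefectAtTwo_depthZero_of_nonTorsion_offHabitat W hCM hred htorQ K hK hHN hodd hne3 htor hH2 Dt β ι hβ
      hex
  | succ r ih =>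
    obtain ⟨m, hm⟩ := ih
    exact ⟨m + c₁, hstep r m hm⟩

end Summit.BirchSwinnertonDyer.BirchSwinnertonDyer.Theorems.KolyvaginAtTwo

end
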